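import Summits.QuantumFields.YangMills.Theorems.BalabanUVNodesN15TwoSpacingGluingGradientGluedCubes
import Summits.QuantumFields.YangMills.Theorems.BalabanUVNodesN15CurvedGluingSmoothCutDressedGluedDefectGaugedUN
import HarnessLib

/-!
# THE GLUING STEP AT TWO LATTICE SPACINGS — THE GRADIENT ENTRIES OF THE GLUED LIVE-BACKGROUND PROPAGATOR, VII: ONE GRID IN THE GLOBAL GAUGE — every flat jet component `∇^±_μ𝒢` of the
# glued propagator of Bałaban's `Δ_{R_U} + P` from dressed smooth-cut cubes at `u ≡ 1` DECAYS (dag-n15-w3 52 with `∇^±_μ∘` in front; dag-n15-c g17, FILE 141; N15 = NE2, s1)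

Cell `pub-ymgap`, seat `pub-ymgap-dag-n15-c` (R134 (a); HUMAN RULING D-0062), generation 17.  `bears_on: R4∕N15 · K3⁸ SpineGivenEndpointR13SepCoPHV (stmt-QuantumFields-27366)`.
Filed `--kind proof --supports stmt-QuantumFields-27366 --as helper` — COUNT-NEUTRAL.  Theorems only; 0 `def`, 0 `sorry`.  Imports BY NAME FILE 141a `…TwoSpacingGluingGradientGluedCubes`
(`hasMaj_jet_glueInv_smoothCutDressed_cubes`) and dag-n15-w3 53 `…CurvedGluingSmoothCutDressedGluedDefectGaugedUN` (`uN_localOp_eq_cut_add_farDefect`; through it 49∕50∕51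
`hasMaj_mulOp_farDefect_smoothCutDressed`, `hasMaj_commOp_farDefect_structural`, `hasMaj_cutPert_structural_of_local`, dag-n15-w2 `coordMat_conj_one`, `mmulOp_one`).  Nothing in the tree is modified.

WHY ∕ WHAT.  dag-n15-w3 52 (`uN_hasMaj_glueInv_smoothCutDressed_localGauges`) is the one-grid `U(m)`-level capstone behind FILES 120∕129 (the live glued propagator decays); FILE 137 is the
two-grid gradient edition at `u ≡ 1`.  THIS FILE is the ONE-GRID gradient edition at `u ≡ 1`: ★★ `one_hasMaj_jet_glueInv_smoothCutDressed` — `∇_j ∘ 𝒢 ≤ K·e^{−(ρ₃−σ)d}` for every jet index `j`,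
`K` = FILE 141a's kernel at 52's letters (`n = η⁻¹`, `θ_F ↦ θ_F·1·β̄′c_r`, `ε_F = 0`), the operand LITERALLY the cover's `∇_j ∘ cvGlued … 1 U P N_V` once instantiated; the sandwiches at `w ≡ 1`
removed by `coordMat_conj_one`∕`mmulOp_one`, 52's discharges (species cut perturbation, covariance identity, far-defect rows, `W`-rows) verbatim at `u ≡ 1`, ONE call of FILE 141a.  This is the
input `pull(∇𝒢)` of the covariant edition `∇_U𝒢 = M_R∘∇𝒢 + M_a𝒢` and the (3.42) one-grid estimate for the flat jets.

HONEST FRAMING ∕ LIMITS.  Composition of LANDED theorems over DISPLAYED rows on King's ∕ dag-n15-a's MODEL carriers; GLOBAL gauge only; FLAT jet; Bałaban's `P`, its law at `w ≡ 1`, `N_V`'s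
letters and 47's rows are HYPOTHESES with located producers; nothing of [B5]∕[B6]∕[B9] asserted ((2.91)–(2.92), (2.133)–(2.136), (3.34)–(3.35), (3.42), (3.50)–(3.53), (3.62)–(3.65) = SHAPES ∕
MECHANISM).  NE2⁺ NOT PRINTED, NOT proved; N15 NOT discharged; K3⁸ OPEN, skeleton v6 untouched (0∕2); counts of record UNMOVED (typed 28∕28 · discharged 5∕27 · A 5∕28); one finite 𝕋⁴ at fixed
ε — NOT infinite volume, NOT OS on ℝ⁴, NOT a mass gap, NOT Clay; R4 closes the conditional finite-𝕋⁴ rung `BalabanLadder.UV` only.  Restate-immune (no Theses import).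
-/

set_option autoImplicit false

noncomputable section
open scoped BigOperators Matrix Matrix.Norms.Frobenius
open Finset

namespace Summit.QuantumFields.YangMills.BalabanUVNodes.N15.Gluing

open Literature.MathematicalPhysics.QuantumFieldTheory.Balaban1983to89
open Literature.MathematicalPhysics.QuantumFieldTheory.Balaban1983to89.B11SectG (BlockNorm HasMaj RowSum hasMaj_zero)
open Literature.MathematicalPhysics.QuantumFieldTheory.Balaban1983to89.B6RandomWalk (Triangle254)
open Literature.MathematicalPhysics.QuantumFieldTheory.Balaban1983to89.B6Prop26Gluing (mulOp mulOp_apply ind ind_nonneg ind_le_one)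
open Summit.QuantumFields.YangMills.BalabanUVNodes.N15.MatrixSpecies (mmulOp liftBlk liftEquiv liftEquiv_apply liftEquiv_symm_apply coordMat)
open Summit.QuantumFields.YangMills.BalabanUVNodes.N15.BackgroundLayer (fgrad bgrad fgradAdj stack projO blkPair liftPair bgPropV covLapM tCoefA tCoefC unstackM projO_none_comp_stack)
open Literature.Barriers.QuantumFields (traceForm)
open Summit.QuantumFields.YangMills.BalabanUVNodes.N15.CurvedSpecies (gaugePair uN_localOp_eq_cut_add_farDefect hasMaj_cutPert_structural_of_local hasMaj_mulOp_farDefect_smoothCutDressed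
  hasMaj_commOp_farDefect_structural coordMat_conj_one mmulOp_one)

variable {X ι J K : Type} [Fintype X] [DecidableEq X] [Fintype ι] [DecidableEq ι] [Fintype J] [DecidableEq J] [Fintype K] {g : B6.Geometry} (blk : X → g.Site) (τ : J → X ≃ X)
  {σ cr : ℝ} {N : K → (X × ι → ℝ) →ₗ[ℝ] (X × ι → ℝ)} {NL : (X × ι → ℝ) →ₗ[ℝ] (X × ι → ℝ)}
  {χX χtX ψX hX : K → X → ℝ} {Sk : K → Set g.Site} {hb : K → g.Site → ℝ} {β β₁ ct δ : ℝ}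

set_option maxHeartbeats 800000 in
/-- ★★ **EVERY FLAT JET COMPONENT OF THE GLUED PROPAGATOR OF BAŁABAN's COVARIANT OPERATOR `Δ_{R_U} + P` FROM DRESSED SMOOTH-CUT CUBES DECAYS, GLOBAL GAUGE** (dag-n15-w3 52 at `u ≡ 1` with
`∇^±_j∘` in front): trace-form coordinates `e` of `𝔲(m)`, bond variables `U`, the cube perturbations = the species of `1·U·1ᴴ` cut to the cube plus the cut nonlocal perturbations `N_V k`, `P`'s
law at `w ≡ 1`, the (3.35) row letters where `χ_k ≠ 0`, `N_V`'s letters ∕ far letters, 47's rows — for every jet index `j`: `∇_j ∘ 𝒢 ≤ K·e^{−(ρ₃−σ)d}`, `K` = FILE 141a's kernel at 52's letters,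
written out below.  The operand is LITERALLY the cover's `∇_j ∘ cvGlued … 1 U P N_V` once instantiated.
[cite: Balaban1985BackgroundPropagators, (3.34)–(3.35) p.396, (3.42) p.397 (gradient entries: shape), (3.50)–(3.53) p.400, (3.62)–(3.65) pp.402–403, (3.76)–(3.77) p.406 (mechanism); Balaban1984PropagatorsII, (2.91) p.239, (2.133)–(2.136) p.247] -/
theorem one_hasMaj_jet_glueInv_smoothCutDressed {m : Type} [Fintype m] [DecidableEq m] (e : Matrix m m ℂ ≃L[ℝ] (ι → ℝ)) {U : J → X → Matrix m m ℂ}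
    {P : (X × ι → ℝ) →ₗ[ℝ] (X × ι → ℝ)} {NV : K → (X × ι → ℝ) →ₗ[ℝ] (X × ι → ℝ)} (η : ℝ) (htri : Triangle254 g) (hd : ∀ a b : g.Site, 0 ≤ g.dist a b) (hd0 : ∀ y : g.Site, g.dist y y = 0) (hsymm : ∀ y y', g.dist y y' = g.dist y' y)
    (hrow : RowSum g σ cr) (hσ : 0 ≤ σ) {ρ₁ ρ₂ ρ₃ ρN ρT δV ε R ε₀ c₁ c₂ θW cN ℓ ω d₁ Nov : ℝ} (hβ : 0 ≤ β) (hβ₁ : 0 ≤ β₁) (hct : 0 ≤ ct) (hR : 0 ≤ R) (hε₀ : 0 ≤ ε₀) (hcr : 0 ≤ cr) (hNov : 0 ≤ Nov) (hσρ : σ ≤ ρ₁) (hρ₁V : ρ₁ ≤ δV)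
    (hρ₁G : ρ₁ + σ ≤ δ) (hρ₂ : 0 ≤ ρ₂) (hρ₂₁ : ρ₂ + σ ≤ ρ₁) (hρ₂T : ρ₂ + σ ≤ ρT) (hρ₃ : 0 ≤ ρ₃) (hρ₃₂ : ρ₃ ≤ ρ₂) (hρ₃V : ρ₃ + σ ≤ δV - ε) (hρ₃N : ρ₃ + σ ≤ ρN) (hσρ₃ : 2 * σ ≤ ρ₃)
    (hε : 0 < ε) (hc₁ : 0 ≤ c₁) (hc₂ : 0 ≤ c₂) (hθW : 0 ≤ θW) (hcN : 0 ≤ cN) (hℓ : 0 ≤ ℓ) (hω : 0 ≤ ω) (hd₁ : 0 ≤ d₁)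
    -- per cube: supports, the bump and its insertions (both ways), the input cut-off
    (hSχ : ∀ k x, χX k x ≠ 0 → blk x ∈ Sk k) (hSψ : ∀ k x, ψX k x ≠ 0 → blk x ∈ Sk k) (hχt : ∀ k x, |χtX k x| ≤ 1)
    (hdχt : ∀ k μ p, |fgrad η⁻¹ (liftEquiv (τ μ) ι) (fun p : X × ι => χtX k p.1) p| ≤ ct) (hdχtb : ∀ k μ p, |bgrad η⁻¹ (liftEquiv (τ μ) ι) (fun p : X × ι => χtX k p.1) p| ≤ ct)
    (hsub : ∀ k, mulOp (fun p : X × ι => χtX k p.1) ∘ₗ mulOp (fun p : X × ι => χX k p.1) = mulOp (fun p : X × ι => χtX k p.1))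
    (hχ : ∀ k, mulOp (fun p : X × ι => χX k p.1) ∘ₗ mulOp (fun p : X × ι => χtX k p.1) = mulOp (fun p : X × ι => χtX k p.1))
    (hs : ∀ k μ, mulOp ((fun p : X × ι => χtX k p.1) ∘ (liftEquiv (τ μ) ι)) ∘ₗ mulOp (fun p : X × ι => χX k p.1) = mulOp ((fun p : X × ι => χtX k p.1) ∘ (liftEquiv (τ μ) ι)))
    (hsb : ∀ k μ, mulOp ((fun p : X × ι => χtX k p.1) ∘ (liftEquiv (τ μ) ι).symm) ∘ₗ mulOp (fun p : X × ι => χX k p.1) = mulOp ((fun p : X × ι => χtX k p.1) ∘ (liftEquiv (τ μ) ι).symm))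
    (hdd : ∀ k μ, mulOp (fgrad η⁻¹ (liftEquiv (τ μ) ι) (fun p : X × ι => χtX k p.1)) ∘ₗ mulOp (fun p : X × ι => χX k p.1) = mulOp (fgrad η⁻¹ (liftEquiv (τ μ) ι) (fun p : X × ι => χtX k p.1)))
    (hddb : ∀ k μ, mulOp (bgrad η⁻¹ (liftEquiv (τ μ) ι) (fun p : X × ι => χtX k p.1)) ∘ₗ mulOp (fun p : X × ι => χX k p.1) = mulOp (bgrad η⁻¹ (liftEquiv (τ μ) ι) (fun p : X × ι => χtX k p.1)))
    (hs' : ∀ k μ, mulOp (fun p : X × ι => χX k p.1) ∘ₗ mulOp ((fun p : X × ι => χtX k p.1) ∘ (liftEquiv (τ μ) ι)) = mulOp ((fun p : X × ι => χtX k p.1) ∘ (liftEquiv (τ μ) ι)))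
    (hsb' : ∀ k μ, mulOp (fun p : X × ι => χX k p.1) ∘ₗ mulOp ((fun p : X × ι => χtX k p.1) ∘ (liftEquiv (τ μ) ι).symm) = mulOp ((fun p : X × ι => χtX k p.1) ∘ (liftEquiv (τ μ) ι).symm))
    (hdd' : ∀ k μ, mulOp (fun p : X × ι => χX k p.1) ∘ₗ mulOp (fgrad η⁻¹ (liftEquiv (τ μ) ι) (fun p : X × ι => χtX k p.1)) = mulOp (fgrad η⁻¹ (liftEquiv (τ μ) ι) (fun p : X × ι => χtX k p.1)))
    (hddb' : ∀ k μ, mulOp (fun p : X × ι => χX k p.1) ∘ₗ mulOp (bgrad η⁻¹ (liftEquiv (τ μ) ι) (fun p : X × ι => χtX k p.1)) = mulOp (bgrad η⁻¹ (liftEquiv (τ μ) ι) (fun p : X × ι => χtX k p.1)))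
    (hNψ : ∀ k, N k ∘ₗ mulOp (fun p : X × ι => ψX k p.1) = N k)
    -- per cube: FILE 63's cut rows
    (hcut : ∀ k, HasMaj (BlockNorm.ofBlocks g (liftBlk blk ι)) (BlockNorm.ofBlocks g (liftBlk blk ι)) (mulOp (fun p : X × ι => χX k p.1) ∘ₗ N k) (fun y y' => ind (Sk k) y * ind (Sk k) y' * (β * Real.exp (-(δ * g.dist y y')))))
    (hcutF : ∀ k μ, HasMaj (BlockNorm.ofBlocks g (liftBlk blk ι)) (BlockNorm.ofBlocks g (liftBlk blk ι)) (mulOp (fun p : X × ι => χX k p.1) ∘ₗ (fgrad η⁻¹ (liftEquiv (τ μ) ι) ∘ₗ N k)) (fun y y' => ind (Sk k) y * ind (Sk k) y' * (β₁ * Real.exp (-(δ * g.dist y y')))))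
    (hcutB : ∀ k μ, HasMaj (BlockNorm.ofBlocks g (liftBlk blk ι)) (BlockNorm.ofBlocks g (liftBlk blk ι)) (mulOp (fun p : X × ι => χX k p.1) ∘ₗ (bgrad η⁻¹ (liftEquiv (τ μ) ι) ∘ₗ N k)) (fun y y' => ind (Sk k) y * ind (Sk k) y' * (β₁ * Real.exp (-(δ * g.dist y y')))))
    -- per cube: the partition (`|h| ≤ 1`, `Σh² = 1`, supported in the cut: `M_hM_χ = M_h`, letters `c₁, c₂`, block reading `hb` with `ℓ, ω`), one-step block distance `d₁`, overlap `N_ov`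
    (hhabs : ∀ k x, |hX k x| ≤ 1) (hhcut : ∀ k, mulOp (fun p : X × ι => hX k p.1) ∘ₗ mulOp (fun p : X × ι => χX k p.1) = mulOp (fun p : X × ι => hX k p.1))
    (hh1 : ∀ k μ p, |fgrad η⁻¹ (liftEquiv (τ μ) ι) (fun p : X × ι => hX k p.1) p| ≤ c₁) (hh1b : ∀ k μ p, |bgrad η⁻¹ (liftEquiv (τ μ) ι) (fun p : X × ι => hX k p.1) p| ≤ c₁) (hh2 : ∀ k μ p, |fgradAdj η⁻¹ (liftEquiv (τ μ) ι) (fgrad η⁻¹ (liftEquiv (τ μ) ι) (fun p : X × ι => hX k p.1)) p| ≤ c₂)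
    (hLip : ∀ k y y', |hb k y - hb k y'| ≤ ℓ * g.dist y y') (hrh : ∀ k (p : X × ι), |hX k p.1 - hb k (liftBlk blk ι p)| ≤ ω) (hstep : ∀ μ x, g.dist (blk (τ μ x)) (blk x) ≤ d₁)
    (hN : ∀ a, ∑ k, ind (Sk k) a ≤ Nov)
    -- per cube: the tail row (dag-n15-a's images geometry ∕ FILE 68's far sandwich)
    (hT : ∀ k, HasMaj (BlockNorm.ofBlocks g (liftBlk blk ι)) (BlockNorm.ofBlocks g (liftBlk blk ι)) ((-(mulOp (fun p : X × ι => hX k p.1) ∘ₗ NL ∘ₗ mulOp (1 - fun p : X × ι => χtX k p.1))) ∘ₗ N k) (fun y y' => ind (Sk k) y * ind (Sk k) y' * (ε₀ * Real.exp (-(ρT * g.dist y y')))))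
    (hq : (β + (β₁ + ct * β)) * (R * cr) * cr < 1)
    (hKN : ∀ k, HasMaj (BlockNorm.ofBlocks g (liftBlk blk ι)) (BlockNorm.ofBlocks g (liftBlk blk ι)) (commOp NL (fun p : X × ι => hX k p.1)) (fun y y' => cN * Real.exp (-(ρN * g.dist y y'))))
    -- THE GLOBAL GAUGE (`u ≡ 1`): trace-form coordinates `e` of `𝔤 = 𝔲(m)`, bond variables `U`, Bałaban's nonlocal summand `P` with `M_W P M_{Wᵀ} = N_L − N_V k` at `w ≡ 1`,
    -- gauge as the flat `N_L` minus a per-cube nonlocal perturbation `N_V k`; the species of the transformed bond variables SMALL WHERE `χ_k ≠ 0` ((3.35) on the cube); letters of `N_V k`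
    (he : ∀ A B : Matrix m m ℂ, traceForm A B = e A ⬝ᵥ e B) {rV RN θF ρF : ℝ} (hrV : 0 ≤ rV) (hRN : 0 ≤ RN) (hθF : 0 ≤ θF) (hρF : ρ₃ + σ ≤ ρF)
    (hRle : rV * (1 + Fintype.card (J ⊕ J)) + RN ≤ R)
    (hP : ∀ k, mmulOp (fun _ => coordMat e (ContinuousLinearMap.mulLeftRight ℝ (Matrix m m ℂ) (1 : Matrix m m ℂ) (1 : Matrix m m ℂ)ᴴ)) ∘ₗ P ∘ₗ mmulOp (fun _ => (coordMat e (ContinuousLinearMap.mulLeftRight ℝ (Matrix m m ℂ) (1 : Matrix m m ℂ) (1 : Matrix m m ℂ)ᴴ))ᵀ) = NL - NV k)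
    (hχ1 : ∀ k x, |χX k x| ≤ 1) (hψχ : ∀ k, mulOp (fun p : X × ι => ψX k p.1) ∘ₗ mulOp (fun p : X × ι => χX k p.1) = mulOp (fun p : X × ι => χX k p.1))
    (hCloc : ∀ k x, χX k x ≠ 0 → ∀ i, ∑ j, |tCoefC η (gaugePair τ fun μ x => coordMat e (ContinuousLinearMap.mulLeftRight ℝ (Matrix m m ℂ) ((1 : Matrix m m ℂ) * U μ x * (1 : Matrix m m ℂ)ᴴ) ((1 : Matrix m m ℂ) * U μ x * (1 : Matrix m m ℂ)ᴴ)ᴴ)) x i j| ≤ rV)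
    (hAloc : ∀ k j' x, χX k x ≠ 0 → ∀ i, ∑ j, |tCoefA η (gaugePair τ fun μ x => coordMat e (ContinuousLinearMap.mulLeftRight ℝ (Matrix m m ℂ) ((1 : Matrix m m ℂ) * U μ x * (1 : Matrix m m ℂ)ᴴ) ((1 : Matrix m m ℂ) * U μ x * (1 : Matrix m m ℂ)ᴴ)ᴴ)) j' x i j| ≤ rV)
    (hNVcut : ∀ k, HasMaj (BlockNorm.ofBlocks g (liftBlk blk ι)) (BlockNorm.ofBlocks g (liftBlk blk ι)) (mulOp (fun p : X × ι => ψX k p.1) ∘ₗ NV k ∘ₗ mulOp (fun p : X × ι => χX k p.1)) (fun y y' => RN * Real.exp (-(δV * g.dist y y'))))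
    (hfarN : ∀ k, HasMaj (BlockNorm.ofBlocks g (liftBlk blk ι)) (BlockNorm.ofBlocks g (liftBlk blk ι)) ((LinearMap.id - mulOp (fun p : X × ι => ψX k p.1)) ∘ₗ NV k ∘ₗ mulOp (fun p : X × ι => χX k p.1)) (fun y y' => θF * Real.exp (-(ρF * g.dist y y'))))
    -- supports of the partition inside `ψ_k` and `χ_k` (with shifts and differences)
    (hhψ : ∀ k, mulOp (fun p : X × ι => hX k p.1) ∘ₗ mulOp (fun p : X × ι => ψX k p.1) = mulOp (fun p : X × ι => hX k p.1)) (hχh : ∀ k, mulOp (fun p : X × ι => χX k p.1) ∘ₗ mulOp (fun p : X × ι => hX k p.1) = mulOp (fun p : X × ι => hX k p.1))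
    (hhs' : ∀ k μ, mulOp (fun p : X × ι => χX k p.1) ∘ₗ mulOp ((fun p : X × ι => hX k p.1) ∘ (liftEquiv (τ μ) ι)) = mulOp ((fun p : X × ι => hX k p.1) ∘ (liftEquiv (τ μ) ι)))
    (hhsb' : ∀ k μ, mulOp (fun p : X × ι => χX k p.1) ∘ₗ mulOp ((fun p : X × ι => hX k p.1) ∘ (liftEquiv (τ μ) ι).symm) = mulOp ((fun p : X × ι => hX k p.1) ∘ (liftEquiv (τ μ) ι).symm))
    (hhdd' : ∀ k μ, mulOp (fun p : X × ι => χX k p.1) ∘ₗ mulOp (fgrad η⁻¹ (liftEquiv (τ μ) ι) (fun p : X × ι => hX k p.1)) = mulOp (fgrad η⁻¹ (liftEquiv (τ μ) ι) (fun p : X × ι => hX k p.1)))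
    (hhddb' : ∀ k μ, mulOp (fun p : X × ι => χX k p.1) ∘ₗ mulOp (bgrad η⁻¹ (liftEquiv (τ μ) ι) (fun p : X × ι => hX k p.1)) = mulOp (bgrad η⁻¹ (liftEquiv (τ μ) ι) (fun p : X × ι => hX k p.1)))
    (hq' : Nov * (((((Fintype.card J : ℝ) * (c₂ * ((β + (β₁ + ct * β)) * (1 - (β + (β₁ + ct * β)) * (R * cr) * cr)⁻¹) + 2 * (c₁ * ((β + (β₁ + ct * β)) * (1 - (β + (β₁ + ct * β)) * (R * cr) * cr)⁻¹))) + θW + cN * ((β + (β₁ + ct * β)) * (1 - (β + (β₁ + ct * β)) * (R * cr) * cr)⁻¹) * cr)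
          + ((ℓ * (Real.exp 1 * ε)⁻¹ + 2 * (ω + ℓ * d₁)) * R * ((β + (β₁ + ct * β)) * (1 - (β + (β₁ + ct * β)) * (R * cr) * cr)⁻¹) * cr + R * c₁ * ((β + (β₁ + ct * β)) * (1 - (β + (β₁ + ct * β)) * (R * cr) * cr)⁻¹) * cr)) + (θF * (1 * ((β + (β₁ + ct * β)) * (1 - (β + (β₁ + ct * β)) * (R * cr) * cr)⁻¹)) * cr)) + ((ε₀ * (1 - (β + (β₁ + ct * β)) * (R * cr) * cr)⁻¹) + 0)) * cr < 1) (j : J ⊕ J) :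
    HasMaj (BlockNorm.ofBlocks g (liftBlk blk ι)) (BlockNorm.ofBlocks g (liftBlk blk ι))
      (Sum.elim (fun μ => fgrad η⁻¹ (liftEquiv (τ μ) ι)) (fun μ => bgrad η⁻¹ (liftEquiv (τ μ) ι)) j ∘ₗ glueInv (parametrix (fun k (p : X × ι) => hX k p.1) (fun k => mmulOp (fun _ => (coordMat e (ContinuousLinearMap.mulLeftRight ℝ (Matrix m m ℂ) (1 : Matrix m m ℂ) (1 : Matrix m m ℂ)ᴴ))ᵀ) ∘ₗ (projO none ∘ₗ bgPropV (stack (mulOp (fun p : X × ι => χtX k p.1) ∘ₗ N k) (fun j => Sum.elim (fun μ => fgrad η⁻¹ (liftEquiv (τ μ) ι)) (fun μ => bgrad η⁻¹ (liftEquiv (τ μ) ι)) j ∘ₗ (mulOp (fun p : X × ι => χtX k p.1) ∘ₗ N k))) (mulOp (fun p : X × ι => ψX k p.1) ∘ₗ (unstackM (tCoefC η (gaugePair τ fun μ x => coordMat e (ContinuousLinearMap.mulLeftRight ℝ (Matrix m m ℂ) ((1 : Matrix m m ℂ) * U μ x * (1 : Matrix m m ℂ)ᴴ) ((1 : Matrix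 m m ℂ) * U μ x * (1 : Matrix m m ℂ)ᴴ)ᴴ)))
            (tCoefA η (gaugePair τ fun μ x => coordMat e (ContinuousLinearMap.mulLeftRight ℝ (Matrix m m ℂ) ((1 : Matrix m m ℂ) * U μ x * (1 : Matrix m m ℂ)ᴴ) ((1 : Matrix m m ℂ) * U μ x * (1 : Matrix m m ℂ)ᴴ)ᴴ))) + NV k ∘ₗ projO none) ∘ₗ mulOp (fun q : (X × ι) × Option (J ⊕ J) => χX k q.1.1))) ∘ₗ mmulOp (fun _ => coordMat e (ContinuousLinearMap.mulLeftRight ℝ (Matrix m m ℂ) (1 : Matrix m m ℂ) (1 : Matrix m m ℂ)ᴴ))))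
        (remainder (covLapM τ η (gaugePair τ (fun μ x => coordMat e (ContinuousLinearMap.mulLeftRight ℝ (Matrix m m ℂ) (U μ x) (U μ x)ᴴ))) + P) (fun k (p : X × ι) => hX k p.1) (fun k => mmulOp (fun _ => (coordMat e (ContinuousLinearMap.mulLeftRight ℝ (Matrix m m ℂ) (1 : Matrix m m ℂ) (1 : Matrix m m ℂ)ᴴ))ᵀ) ∘ₗ (projO none ∘ₗ bgPropV (stack (mulOp (fun p : X × ι => χtX k p.1) ∘ₗ N k) (fun j => Sum.elim (fun μ => fgrad η⁻¹ (liftEquiv (τ μ) ι)) (fun μ => bgrad η⁻¹ (liftEquiv (τ μ) ι)) j ∘ₗ (mulOp (fun p : X × ι => χtX k p.1) ∘ₗ N k))) (mulOp (fun p : X × ι => ψX k p.1) ∘ₗ (unstackM (tCoefC η (gaugePair τ fun μ x => coordMat e (ContinuousLinearMap.mulLeftRight ℝ (Matrix m m ℂ) ((1 : Matrix m m ℂ) * U μ x * (1 : Matrix m m ℂ)ᴴ) ((1 : Matrix m m ℂ) * U μ x * (1 : Matrix m m ℂ)ᴴ)ᴴ)))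
            (tCoefA η (gaugePair τ fun μ x => coordMat e (ContinuousLinearMap.mulLeftRight ℝ (Matrix m m ℂ) ((1 : Matrix m m ℂ) * U μ x * (1 : Matrix m m ℂ)ᴴ) ((1 : Matrix m m ℂ) * U μ x * (1 : Matrix m m ℂ)ᴴ)ᴴ))) + NV k ∘ₗ projO none) ∘ₗ mulOp (fun q : (X × ι) × Option (J ⊕ J) => χX k q.1.1))) ∘ₗ mmulOp (fun _ => coordMat e (ContinuousLinearMap.mulLeftRight ℝ (Matrix m m ℂ) (1 : Matrix m m ℂ) (1 : Matrix m m ℂ)ᴴ))) -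
          ∑ k, (mmulOp (fun _ => (coordMat e (ContinuousLinearMap.mulLeftRight ℝ (Matrix m m ℂ) (1 : Matrix m m ℂ) (1 : Matrix m m ℂ)ᴴ))ᵀ) ∘ₗ ((((-(mulOp (fun p : X × ι => hX k p.1) ∘ₗ NL ∘ₗ mulOp (1 - fun p : X × ι => χtX k p.1))) ∘ₗ N k) ∘ₗ (LinearMap.id + ((mulOp (fun p : X × ι => ψX k p.1) ∘ₗ (unstackM (tCoefC η (gaugePair τ fun μ x => coordMat e (ContinuousLinearMap.mulLeftRight ℝ (Matrix m m ℂ) ((1 : Matrix m m ℂ) * U μ x * (1 : Matrix m m ℂ)ᴴ) ((1 : Matrix m m ℂ) * U μ x * (1 : Matrix m m ℂ)ᴴ)ᴴ)))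
            (tCoefA η (gaugePair τ fun μ x => coordMat e (ContinuousLinearMap.mulLeftRight ℝ (Matrix m m ℂ) ((1 : Matrix m m ℂ) * U μ x * (1 : Matrix m m ℂ)ᴴ) ((1 : Matrix m m ℂ) * U μ x * (1 : Matrix m m ℂ)ᴴ)ᴴ))) + NV k ∘ₗ projO none) ∘ₗ mulOp (fun q : (X × ι) × Option (J ⊕ J) => χX k q.1.1)) ∘ₗ stack LinearMap.id (fun j => Sum.elim (fun μ => fgrad η⁻¹ (liftEquiv (τ μ) ι)) (fun μ => bgrad η⁻¹ (liftEquiv (τ μ) ι)) j)) ∘ₗ (projO none ∘ₗ bgPropV (stack (mulOp (fun p : X × ι => χtX k p.1) ∘ₗ N k) (fun j => Sum.elim (fun μ => fgrad η⁻¹ (liftEquiv (τ μ) ι)) (fun μ => bgrad η⁻¹ (liftEquiv (τ μ) ι)) j ∘ₗ (mulOp (fun p : X × ι => χtX k p.1) ∘ₗ N k))) (mulOp (fun p : X × ι => ψX k p.1) ∘ₗ (unstackM (tCoefC η (gaugePair τ fun μ x => coordMat e (ContinuousLinearMap.mulLeftRight ℝ (Matrix m m ℂ) ((1 : Matrix m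 m ℂ) * U μ x * (1 : Matrix m m ℂ)ᴴ) ((1 : Matrix m m ℂ) * U μ x * (1 : Matrix m m ℂ)ᴴ)ᴴ)))
            (tCoefA η (gaugePair τ fun μ x => coordMat e (ContinuousLinearMap.mulLeftRight ℝ (Matrix m m ℂ) ((1 : Matrix m m ℂ) * U μ x * (1 : Matrix m m ℂ)ᴴ) ((1 : Matrix m m ℂ) * U μ x * (1 : Matrix m m ℂ)ᴴ)ᴴ))) + NV k ∘ₗ projO none) ∘ₗ mulOp (fun q : (X × ι) × Option (J ⊕ J) => χX k q.1.1)))) + mulOp (fun p : X × ι => hX k p.1) ∘ₗ (-(((unstackM (tCoefC η (gaugePair τ fun μ x => coordMat e (ContinuousLinearMap.mulLeftRight ℝ (Matrix m m ℂ) ((1 : Matrix m m ℂ) * U μ x * (1 : Matrix m m ℂ)ᴴ) ((1 : Matrix m m ℂ) * U μ x * (1 : Matrix m m ℂ)ᴴ)ᴴ)))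
            (tCoefA η (gaugePair τ fun μ x => coordMat e (ContinuousLinearMap.mulLeftRight ℝ (Matrix m m ℂ) ((1 : Matrix m m ℂ) * U μ x * (1 : Matrix m m ℂ)ᴴ) ((1 : Matrix m m ℂ) * U μ x * (1 : Matrix m m ℂ)ᴴ)ᴴ))) + NV k ∘ₗ projO none) - mulOp (fun p : X × ι => ψX k p.1) ∘ₗ (unstackM (tCoefC η (gaugePair τ fun μ x => coordMat e (ContinuousLinearMap.mulLeftRight ℝ (Matrix m m ℂ) ((1 : Matrix m m ℂ) * U μ x * (1 : Matrix m m ℂ)ᴴ) ((1 : Matrix m m ℂ) * U μ x * (1 : Matrix m m ℂ)ᴴ)ᴴ)))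
            (tCoefA η (gaugePair τ fun μ x => coordMat e (ContinuousLinearMap.mulLeftRight ℝ (Matrix m m ℂ) ((1 : Matrix m m ℂ) * U μ x * (1 : Matrix m m ℂ)ᴴ) ((1 : Matrix m m ℂ) * U μ x * (1 : Matrix m m ℂ)ᴴ)ᴴ))) + NV k ∘ₗ projO none) ∘ₗ mulOp (fun q : (X × ι) × Option (J ⊕ J) => χX k q.1.1)) ∘ₗ stack LinearMap.id (fun j => Sum.elim (fun μ => fgrad η⁻¹ (liftEquiv (τ μ) ι)) (fun μ => bgrad η⁻¹ (liftEquiv (τ μ) ι)) j))) ∘ₗ (projO none ∘ₗ bgPropV (stack (mulOp (fun p : X × ι => χtX k p.1) ∘ₗ N k) (fun j => Sum.elim (fun μ => fgrad η⁻¹ (liftEquiv (τ μ) ι)) (fun μ => bgrad η⁻¹ (liftEquiv (τ μ) ι)) j ∘ₗ (mulOp (fun p : X × ι => χtX k p.1) ∘ₗ N k))) (mulOp (fun p : X × ι => ψX k p.1) ∘ₗ (unstackM (tCoefC η (gaugePair τ fun μ x => coordMat e (ContinuousLinearMap.mulLeftRight ℝ (Matrix m m ℂ) ((1 : Matrix m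 m ℂ) * U μ x * (1 : Matrix m m ℂ)ᴴ) ((1 : Matrix m m ℂ) * U μ x * (1 : Matrix m m ℂ)ᴴ)ᴴ)))
            (tCoefA η (gaugePair τ fun μ x => coordMat e (ContinuousLinearMap.mulLeftRight ℝ (Matrix m m ℂ) ((1 : Matrix m m ℂ) * U μ x * (1 : Matrix m m ℂ)ᴴ) ((1 : Matrix m m ℂ) * U μ x * (1 : Matrix m m ℂ)ᴴ)ᴴ))) + NV k ∘ₗ projO none) ∘ₗ mulOp (fun q : (X × ι) × Option (J ⊕ J) => χX k q.1.1))))) ∘ₗ mmulOp (fun _ => coordMat e (ContinuousLinearMap.mulLeftRight ℝ (Matrix m m ℂ) (1 : Matrix m m ℂ) (1 : Matrix m m ℂ)ᴴ))) ∘ₗ mulOp (fun p : X × ι => hX k p.1)))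
      (fun y y' => Nov * (1 * ((β + (β₁ + ct * β)) * (1 - (β + (β₁ + ct * β)) * (R * cr) * cr)⁻¹) + c₁ * ((β + (β₁ + ct * β)) * (1 - (β + (β₁ + ct * β)) * (R * cr) * cr)⁻¹)) * (1 - Nov * ((((((Fintype.card J : ℝ) * (c₂ * ((β + (β₁ + ct * β)) * (1 - (β + (β₁ + ct * β)) * (R * cr) * cr)⁻¹) + 2 * (c₁ * ((β + (β₁ + ct * β)) * (1 - (β + (β₁ + ct * β)) * (R * cr) * cr)⁻¹))) + θW + cN * ((β + (β₁ + ct * β)) * (1 - (β + (β₁ + ct * β)) * (R * cr) * cr)⁻¹) * cr)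
          + ((ℓ * (Real.exp 1 * ε)⁻¹ + 2 * (ω + ℓ * d₁)) * R * ((β + (β₁ + ct * β)) * (1 - (β + (β₁ + ct * β)) * (R * cr) * cr)⁻¹) * cr + R * c₁ * ((β + (β₁ + ct * β)) * (1 - (β + (β₁ + ct * β)) * (R * cr) * cr)⁻¹) * cr)) + (θF * (1 * ((β + (β₁ + ct * β)) * (1 - (β + (β₁ + ct * β)) * (R * cr) * cr)⁻¹)) * cr))) + (((ε₀ * (1 - (β + (β₁ + ct * β)) * (R * cr) * cr)⁻¹) + 0))) * cr)⁻¹ * cr * Real.exp (-((ρ₃ - σ) * g.dist y y'))) := by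
  -- `w ≡ 1`: the gauge sandwiches are the identity (dag-n15-w2 `coordMat_conj_one`, `mmulOp_one`)
  simp only [coordMat_conj_one, Matrix.transpose_one, mmulOp_one, LinearMap.id_comp, LinearMap.comp_id]
  have hβb : 0 ≤ β + (β₁ + ct * β) := by positivity
  have hqi : 0 ≤ (1 - (β + (β₁ + ct * β)) * (R * cr) * cr)⁻¹ := inv_nonneg.2 (by linarith)
  have hB : 0 ≤ ((β + (β₁ + ct * β)) * (1 - (β + (β₁ + ct * β)) * (R * cr) * cr)⁻¹) := mul_nonneg hβb hqi
  have hcovW := fun k => by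
    have h := uN_localOp_eq_cut_add_farDefect τ e (fun _ => (1 : Matrix m m ℂ)) U (χX k) (ψX k) η he (fun _ => by rw [Matrix.conjTranspose_one, Matrix.mul_one]) (hP k)
    simp only [coordMat_conj_one, Matrix.transpose_one, mmulOp_one, LinearMap.id_comp, LinearMap.comp_id] at h
    exact h
  have hV : ∀ k, HasMaj (BlockNorm.ofBlocks g (blkPair (liftBlk blk ι))) (BlockNorm.ofBlocks g (liftBlk blk ι)) (mulOp (fun p : X × ι => ψX k p.1) ∘ₗ (unstackM (tCoefC η (gaugePair τ fun μ x => coordMat e (ContinuousLinearMap.mulLeftRight ℝ (Matrix m m ℂ) ((1 : Matrix m m ℂ) * U μ x * (1 : Matrix m m ℂ)ᴴ) ((1 : Matrix m m ℂ) * U μ x * (1 : Matrix m m ℂ)ᴴ)ᴴ)))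
            (tCoefA η (gaugePair τ fun μ x => coordMat e (ContinuousLinearMap.mulLeftRight ℝ (Matrix m m ℂ) ((1 : Matrix m m ℂ) * U μ x * (1 : Matrix m m ℂ)ᴴ) ((1 : Matrix m m ℂ) * U μ x * (1 : Matrix m m ℂ)ᴴ)ᴴ))) + NV k ∘ₗ projO none) ∘ₗ mulOp (fun q : (X × ι) × Option (J ⊕ J) => χX k q.1.1)) (fun y y' => R * Real.exp (-(δV * g.dist y y'))) := fun k =>
    (hasMaj_cutPert_structural_of_local blk hd0 hrV hRN (hχ1 k) (hCloc k) (fun μ x hx => hAloc k μ x hx) (hψχ k) (hNVcut k)).mono fun y y' =>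
      mul_le_mul_of_nonneg_right hRle (Real.exp_nonneg _)
  have hW : ∀ k, HasMaj (BlockNorm.ofBlocks g (liftBlk blk ι)) (BlockNorm.ofBlocks g (liftBlk blk ι)) (commOp (0 : (X × ι → ℝ) →ₗ[ℝ] (X × ι → ℝ)) (fun p : X × ι => hX k p.1) ∘ₗ (projO none ∘ₗ bgPropV (stack (mulOp (fun p : X × ι => χtX k p.1) ∘ₗ N k)
          (fun j => Sum.elim (fun μ => fgrad η⁻¹ (liftEquiv (τ μ) ι)) (fun μ => bgrad η⁻¹ (liftEquiv (τ μ) ι)) j ∘ₗ (mulOp (fun p : X × ι => χtX k p.1) ∘ₗ N k))) (mulOp (fun p : X × ι => ψX k p.1) ∘ₗ (unstackM (tCoefC η (gaugePair τ fun μ x => coordMat e (ContinuousLinearMap.mulLeftRight ℝ (Matrix m m ℂ) ((1 : Matrix m m ℂ) * U μ x * (1 : Matrix m m ℂ)ᴴ) ((1 : Matrix m m ℂ) * U μ x * (1 : Matrix m m ℂ)ᴴ)ᴴ)))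
            (tCoefA η (gaugePair τ fun μ x => coordMat e (ContinuousLinearMap.mulLeftRight ℝ (Matrix m m ℂ) ((1 : Matrix m m ℂ) * U μ x * (1 : Matrix m m ℂ)ᴴ) ((1 : Matrix m m ℂ) * U μ x * (1 : Matrix m m ℂ)ᴴ)ᴴ))) + NV k ∘ₗ projO none) ∘ₗ mulOp (fun q : (X × ι) × Option (J ⊕ J) => χX k q.1.1))))
      (fun y y' => ind (Sk k) y * ind (Sk k) y' * (θW * Real.exp (-(ρ₂ * g.dist y y')))) := fun k => by
    rw [show commOp (0 : (X × ι → ℝ) →ₗ[ℝ] (X × ι → ℝ)) (fun p : X × ι => hX k p.1) = 0 from by simp [commOp], LinearMap.zero_comp]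
    exact (hasMaj_zero _ _).mono fun y y' => mul_nonneg (mul_nonneg (ind_nonneg _ _) (ind_nonneg _ _)) (mul_nonneg hθW (Real.exp_nonneg _))
  have hFX := fun k => hasMaj_mulOp_farDefect_smoothCutDressed blk τ η⁻¹ (Vf := (unstackM (tCoefC η (gaugePair τ fun μ x => coordMat e (ContinuousLinearMap.mulLeftRight ℝ (Matrix m m ℂ) ((1 : Matrix m m ℂ) * U μ x * (1 : Matrix m m ℂ)ᴴ) ((1 : Matrix m m ℂ) * U μ x * (1 : Matrix m m ℂ)ᴴ)ᴴ)))
            (tCoefA η (gaugePair τ fun μ x => coordMat e (ContinuousLinearMap.mulLeftRight ℝ (Matrix m m ℂ) ((1 : Matrix m m ℂ) * U μ x * (1 : Matrix m m ℂ)ᴴ) ((1 : Matrix m m ℂ) * U μ x * (1 : Matrix m m ℂ)ᴴ)ᴴ))) + NV k ∘ₗ projO none)) htri hd hrow hσ hβ hβ₁ hct hR hcr hσρ hρ₁V hρ₁G hρ₂ hρ₂₁ (hχt k) (hdχt k) (hdχtb k) (hsub k) (hχ k) (hs k)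
    (hsb k) (hdd k) (hddb k) (hs' k) (hsb' k) (hdd' k) (hddb' k) (hcut k) (hcutF k) (hcutB k) (hV k) hq (hhψ k) ρ₃
  have hFK := fun k => hasMaj_commOp_farDefect_structural blk τ η⁻¹ (NV := NV k)
    (Cc := tCoefC η (gaugePair τ fun μ x => coordMat e (ContinuousLinearMap.mulLeftRight ℝ (Matrix m m ℂ) ((1 : Matrix m m ℂ) * U μ x * (1 : Matrix m m ℂ)ᴴ) ((1 : Matrix m m ℂ) * U μ x * (1 : Matrix m m ℂ)ᴴ)ᴴ)))
    (Ac := tCoefA η (gaugePair τ fun μ x => coordMat e (ContinuousLinearMap.mulLeftRight ℝ (Matrix m m ℂ) ((1 : Matrix m m ℂ) * U μ x * (1 : Matrix m m ℂ)ᴴ) ((1 : Matrix m m ℂ) * U μ x * (1 : Matrix m m ℂ)ᴴ)ᴴ))) htri hd hrow hσ hβ hβ₁ hct hR hcr hσρ hρ₁V hρ₁G hρ₂ hρ₂₁ (hSχ k) (hSψ k) (hχt k) (hdχt k) (hdχtb k) (hsub k) (hχ k) (hs k)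
    (hsb k) (hdd k) (hddb k) (hs' k) (hsb' k) (hdd' k) (hddb' k) (hNψ k) (hcut k) (hcutF k) (hcutB k) (hV k) hq hθF hρ₃ hρ₃₂ hρF (hhabs k) (hhψ k) (hχh k) (hhs' k) (hhsb' k) (hhdd' k)
    (hhddb' k) (hψχ k) (hfarN k)
  have hθF' : 0 ≤ θF * (1 * ((β + (β₁ + ct * β)) * (1 - (β + (β₁ + ct * β)) * (R * cr) * cr)⁻¹)) * cr := by positivity
  exact hasMaj_jet_glueInv_smoothCutDressed_cubes blk τ η⁻¹ htri hd hd0 hsymm hrow hσ hβ hβ₁ hct hR hε₀ hcr hNov hσρ hρ₁V hρ₁G hρ₂ hρ₂₁ hρ₂T hρ₃ hρ₃₂ hρ₃V hρ₃N hσρ₃ hε hc₁ hc₂ hθW hcN hℓ hω hd₁ hSχ hSψ hχt hdχt hdχtb hsub hχ hs hsb hdd hddb hs' hsb' hdd' hddb' hNψ hcut hcutF hcutB hhabs hhcut hh1 hh1b hh2 hLip hrh hstep hN hT hV hq hW hKN hθF' (le_refl (0:ℝ)) hcovW hFK hFX hq' j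

end Summit.QuantumFields.YangMills.BalabanUVNodes.N15.Gluing

end
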